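import Mathlib
import Summits.Ventures.PercRepro2.Defs
import Summits.Ventures.PercRepro2.Graph
import Summits.Ventures.PercRepro2.Events
import Summits.Ventures.PercRepro2.Exploration

/-!
# Root-only pockets are invisible under `Q`

A *pocket* `P` (for the roots `a₁, a₂`) is a vertex set all of whose neighbours lie in `P` or
among the two roots.  On the event `Q = {a₁ ↮ a₂}` the pocket is invisible to the rest of the
graph: a connection between two vertices outside `P` never uses a pocket edge (Lemma 1), and a
root reaches a pocket vertex if and only if it does so inside the pocket (Lemma 2).  These are
the graph-theoretic halves of the root-only-pocket theorem: `(HMF)` and `(HCOV)` hold whenever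
`{a₁, a₂}` separates `a₃` from `{o, b}`.

Both proofs are the closure argument of `conn_restrict_iff_of_cluster_eq`: a set containing the
start vertex and closed under open edges contains every vertex connected to it.
-/

namespace Summit.Ventures.PercRepro2

namespace PocketConn

variable {V : Type*} {E : Type*}

/-- `P` is a *root-only pocket* for the roots `a₁, a₂`: every edge leaving a vertex of `P` ends in
`P` or at a root. -/
def IsPocket (ends : E → Sym2 V) (P : Set V) (a₁ a₂ : V) : Prop :=
  ∀ e x y, ends e = s(x, y) → x ∈ P → y ∈ P ∨ y = a₁ ∨ y = a₂

/-- Symmetric form of the pocket condition: an endpoint of an edge whose other endpoint lies in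
`P` is in `P` or a root. -/
lemma IsPocket.other {ends : E → Sym2 V} {P : Set V} {a₁ a₂ : V} (hP : IsPocket ends P a₁ a₂)
    {e : E} {x y : V} (h : ends e = s(x, y)) (hy : y ∈ P) : x ∈ P ∨ x = a₁ ∨ x = a₂ :=
  hP e y x (by rw [h, Sym2.eq_swap]) hy

/-- An open edge of `ω` with an endpoint in `P` is open in the pocket configuration
`restrict (touches ends P) ω`. -/
lemma openAdj_restrict_touches {ends : E → Sym2 V} {P : Set V}
    [DecidablePred (· ∈ touches ends P)] {ω : Config E} {e : E} {x y : V}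
    (he : ω e = true) (hends : ends e = s(x, y)) (hxy : x ∈ P ∨ y ∈ P) :
    OpenAdj ends (restrict (touches ends P) ω) x y :=
  ⟨e, restrict_eq_true_iff.2 ⟨he, mem_touches_of_ends hends hxy⟩, hends⟩

/-- An open edge of `ω` with both endpoints outside `P` is open in the outside configuration
`restrict (touches ends P)ᶜ ω`. -/
lemma openAdj_restrict_compl {ends : E → Sym2 V} {P : Set V}
    [DecidablePred (· ∈ (touches ends P)ᶜ)] {ω : Config E} {e : E} {x y : V}
    (he : ω e = true) (hends : ends e = s(x, y)) (hx : x ∉ P) (hy : y ∉ P) :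
    OpenAdj ends (restrict (touches ends P)ᶜ ω) x y := by
  refine ⟨e, restrict_eq_true_iff.2 ⟨he, ?_⟩, hends⟩
  rintro ⟨x', hx', y', hends'⟩
  rw [hends, Sym2.eq_iff] at hends'
  rcases hends' with ⟨rfl, _⟩ | ⟨_, rfl⟩
  · exact hx hx'
  · exact hy hx'

/-- **Lemma 1 (pocket invisibility).**  On `Q = {a₁ ↮ a₂}`, two vertices outside a root-only
pocket `P` are connected if and only if they are connected by edges not touching `P`. -/
theorem conn_iff_conn_restrict {ends : E → Sym2 V} {ω : Config E} {P : Set V} {a₁ a₂ : V}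
    [DecidablePred (· ∈ (touches ends P)ᶜ)] (hP : IsPocket ends P a₁ a₂)
    (hQ : ¬ Conn ends ω a₁ a₂) {x y : V} (hx : x ∉ P) (hy : y ∉ P) :
    Conn ends ω x y ↔ Conn ends (restrict (touches ends P)ᶜ ω) x y := by
  classical
  constructor
  · intro h
    -- the closed set: outside `P` reached by outside edges, or inside `P` reached from a root
    -- that is itself reached by outside edges
    set ω₁ := restrict (touches ends P)ᶜ ω with hω₁
    set ωP := restrict (touches ends P) ω with hωP
    have hPle : ωP ≤ ω := restrict_le _ ω
    have key : y ∈ {z | (z ∉ P ∧ Conn ends ω₁ x z) ∨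
        (z ∈ P ∧ ((Conn ends ω₁ x a₁ ∧ Conn ends ωP z a₁) ∨
          (Conn ends ω₁ x a₂ ∧ Conn ends ωP z a₂)))} := by
      refine mem_of_conn_of_closed (ends := ends) (ω := ω) ?_ (Or.inl ⟨hx, conn_refl _ _ _⟩) h
      rintro z hz w hzw
      obtain ⟨_, e, he, hends⟩ := openGraph_adj.1 hzw
      simp only [Set.mem_setOf_eq] at hz ⊢
      rcases hz with ⟨hzP, hzc⟩ | ⟨hzP, hzc⟩
      · -- `z` outside `P`
        by_cases hwP : w ∈ P
        · -- the edge enters `P`: `z` must be a root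
          rcases hP.other hends hwP with hzP' | rfl | rfl
          · exact absurd hzP' hzP
          · exact Or.inr ⟨hwP, Or.inl ⟨hzc,
              conn_of_openAdj (openAdj_restrict_touches he hends (Or.inr hwP)).symm⟩⟩
          · exact Or.inr ⟨hwP, Or.inr ⟨hzc,
              conn_of_openAdj (openAdj_restrict_touches he hends (Or.inr hwP)).symm⟩⟩
        · exact Or.inl ⟨hwP, conn_trans hzc
            (conn_of_openAdj (openAdj_restrict_compl he hends hzP hwP))⟩
      · -- `z` inside `P`: the edge is a pocket edge
        have hwz : Conn ends ωP w z :=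
          conn_of_openAdj (openAdj_restrict_touches he hends (Or.inl hzP)).symm
        by_cases hwP : w ∈ P
        · refine Or.inr ⟨hwP, ?_⟩
          rcases hzc with ⟨h1, h2⟩ | ⟨h1, h2⟩
          · exact Or.inl ⟨h1, conn_trans hwz h2⟩
          · exact Or.inr ⟨h1, conn_trans hwz h2⟩
        · -- the edge leaves `P`: `w` is a root
          rcases hP e z w hends hzP with hwP' | rfl | rfl
          · exact absurd hwP' hwP
          · rcases hzc with ⟨h1, _⟩ | ⟨_, h2⟩
            · exact Or.inl ⟨hwP, h1⟩
            · exact absurd (conn_mono hPle (conn_trans hwz h2)) hQ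
          · rcases hzc with ⟨_, h2⟩ | ⟨h1, _⟩
            · exact absurd (conn_symm (conn_mono hPle (conn_trans hwz h2))) hQ
            · exact Or.inl ⟨hwP, h1⟩
    simp only [Set.mem_setOf_eq] at key
    rcases key with ⟨_, h'⟩ | ⟨hyP, _⟩
    · exact h'
    · exact absurd hyP hy
  · exact conn_mono (restrict_le _ ω)

/-- **Lemma 2 (root reach).**  On `Q`, a root `r ∈ {a₁, a₂}` is connected to a pocket vertex
`v ∈ P` if and only if it is connected to it inside the pocket. -/
theorem conn_root_iff_conn_restrict {ends : E → Sym2 V} {ω : Config E} {P : Set V} {a₁ a₂ : V}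
    [DecidablePred (· ∈ touches ends P)] (hP : IsPocket ends P a₁ a₂)
    (hQ : ¬ Conn ends ω a₁ a₂) {r : V} (hr : r = a₁ ∨ r = a₂) {v : V} (hv : v ∈ P) :
    Conn ends ω r v ↔ Conn ends (restrict (touches ends P) ω) v r := by
  classical
  set ωP := restrict (touches ends P) ω with hωP
  have hPle : ωP ≤ ω := restrict_le _ ω
  -- the other root is not reachable from `r`
  have hother : ∀ s, s = a₁ ∨ s = a₂ → s ≠ r → ¬ Conn ends ω s r := by
    intro s hs hsr hc
    rcases hr with rfl | rfl <;> rcases hs with rfl | rfl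
    · exact hsr rfl
    · exact hQ (conn_symm hc)
    · exact hQ hc
    · exact hsr rfl
  constructor
  · intro h
    have key : v ∈ {z | (z ∈ P ∧ Conn ends ωP z r) ∨ (z ∉ P ∧ Conn ends ω r z)} := by
      refine mem_of_conn_of_closed (ends := ends) (ω := ω) ?_ ?_ h
      · rintro z hz w hzw
        obtain ⟨_, e, he, hends⟩ := openGraph_adj.1 hzw
        simp only [Set.mem_setOf_eq] at hz ⊢
        rcases hz with ⟨hzP, hzc⟩ | ⟨hzP, hzc⟩
        · -- `z` inside `P`: the edge is a pocket edge
          have hwz : Conn ends ωP w z :=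
            conn_of_openAdj (openAdj_restrict_touches he hends (Or.inl hzP)).symm
          by_cases hwP : w ∈ P
          · exact Or.inl ⟨hwP, conn_trans hwz hzc⟩
          · rcases hP e z w hends hzP with hwP' | hw | hw
            · exact absurd hwP' hwP
            · by_cases hwr : w = r
              · exact Or.inr ⟨hwP, hwr ▸ conn_refl _ _ _⟩
              · exact absurd (conn_mono hPle (conn_trans hwz hzc)) (hother w (Or.inl hw) hwr)
            · by_cases hwr : w = r
              · exact Or.inr ⟨hwP, hwr ▸ conn_refl _ _ _⟩
              · exact absurd (conn_mono hPle (conn_trans hwz hzc)) (hother w (Or.inr hw) hwr)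
        · -- `z` outside `P`
          by_cases hwP : w ∈ P
          · -- the edge enters `P`: `z` is a root, hence `z = r`
            have hzr : z = r := by
              rcases hP.other hends hwP with hzP' | hz | hz
              · exact absurd hzP' hzP
              · by_contra hzr
                exact hother z (Or.inl hz) hzr (conn_symm hzc)
              · by_contra hzr
                exact hother z (Or.inr hz) hzr (conn_symm hzc)
            exact Or.inl ⟨hwP, hzr ▸
              conn_of_openAdj (openAdj_restrict_touches he hends (Or.inr hwP)).symm⟩
          · exact Or.inr ⟨hwP, conn_trans hzc (conn_of_openAdj ⟨e, he, hends⟩)⟩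
      · by_cases hrP : r ∈ P
        · exact Or.inl ⟨hrP, conn_refl _ _ _⟩
        · exact Or.inr ⟨hrP, conn_refl _ _ _⟩
    simp only [Set.mem_setOf_eq] at key
    rcases key with ⟨_, h'⟩ | ⟨hvP, _⟩
    · exact h'
    · exact absurd hv hvP
  · intro h
    exact conn_symm (conn_mono hPle h)

/-- Event form of Lemma 1: on `Q`, the connection event of two vertices outside a finite pocket
`W` coincides with the connection event of the graph with the edges touching `W` removed. -/
theorem Q_inter_connEvent_eq_connDelEvent [Fintype V] [DecidableEq V] (ends : E → Sym2 V)
    (W : Finset V) (a₁ a₂ : V) (hP : IsPocket ends (↑W : Set V) a₁ a₂)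
    {x y : V} (hx : x ∉ W) (hy : y ∉ W) :
    (connEvent ends a₁ a₂)ᶜ ∩ connEvent ends x y =
      (connEvent ends a₁ a₂)ᶜ ∩ connDelEvent ends W x y := by
  ext ω
  simp only [Set.mem_inter_iff, Set.mem_compl_iff, mem_connEvent, mem_connDelEvent]
  constructor
  · rintro ⟨hQ, h⟩
    exact ⟨hQ, (conn_iff_conn_restrict hP hQ (by simpa using hx) (by simpa using hy)).1 h⟩
  · rintro ⟨hQ, h⟩
    exact ⟨hQ, (conn_iff_conn_restrict hP hQ (by simpa using hx) (by simpa using hy)).2 h⟩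

end PocketConn

end Summit.Ventures.PercRepro2
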